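import Summits.QuantumFields.BalabanUV.T4Continuum.Support.SubstrateGaugeSize
import Summits.QuantumFields.BalabanUV.T4Continuum.Support.SubstrateVocabularyV3
import Summits.QuantumFields.BalabanUV.T4Continuum.Support.SubstrateDrivenRecordSU

/-!
# SUBSTRATE — THE VARIATIONAL PROBLEM OF RECORD: r2's carrier `B11.VarProblem` INSTANTIATED on the V1 objects of the O1 instance
# (constraint = the averaging OF RECORD, minimal orbit = `Setup.IsBackground`, regularity fields = `SubstrateGaugeSize` on the V3 lift),
# its realisation `TermwiseHolder.Realises` BY CONSTRUCTION, and the existence clause (8) on the reachable data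
# ([dict] D-3 for the problem of record; MAP v0.6 §3 row NE7 NODE O.3′ «famA∕famB := recordVP»; typer GO l.~15385)

Cell `pub-balaban`, SUBSTRATE cell, seat `b2b-balaban-substrate-p2` (gen 2).  Summits-side under the LEAN PLACEMENT RULE.  HONEST FRAMING:
rung (B)+1 of the FINITE-VOLUME T⁴ programme — NOT infinite volume, NOT a mass gap, NOT Clay; spine PROVED 0∕9; NE3 ∕ NE7 NOT proved.
**B11 Theorem 1 is asserted NOWHERE**: `B11Thm1.Thm1At C (recordVP …)` stays row NE7's ∕ NE3's DISPLAYED hypothesis — Theorem 1 of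
[Balaban1985Variational] FOR THE PROBLEM CONSTRAINED BY THE AVERAGING OF RECORD (that the theorem holds for it is print's claim,
[Balaban1987RG1] p. 253 «they are valid universally for all averages satisfying the above properties» [sc. (0.5)–(0.9)], not the tree's).
No estimate; no cite tag on an asserted printed statement; nothing of rows NE3∕NE7 is modified (`MinimalActionDictionary*`, `TermwiseHolder*` are
only IMPORTED — typer condition (b)).  v1.0.1 = DOCFIX (XREAD C-ne9leaf07g13-1: DL-1∕2∕3, D-rec-6, run-B note R-ne9leaf07g13-1); declarations unchanged.
HONEST DEPENDENCY (cell line, verbatim): continuum YM on T⁴ ⇐ BetaPertH ∧ nine spine estimates (0/9 proved); BetaPertH ⇐ (D1) ∧ (D4) ∧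
CAP+tail; G-an2-4 gates asym, D1 and NE2/3/4.

WHY.  Row NE7's term-wise END consumes `famA famB : … → B11.VarProblem`, `ρA ρB : Realises (fam…) 4 (Matrix n n ℂ)`, minimal-orbit configurations
`UA UB` and the displayed `hTA hTB : Thm1At Cst (fam…)`; MAP v0.5 §3 pointed `famA∕famB` at NE3's `MinimalActionDictionary.torusVP`, which (R-SUB-p2-1,
ACCEPTED v0.6) cannot serve: `holderA := 0` makes `Realises` demand affine potentials, and its constraint is B7 (42)'s `avgIter`, not the averaging
of record (F-SUB-p2-3: the two differ at first order).  This module supplies the carrier OF RECORD: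

* §1 `eta L k = L^{−k}`, `sf L k j = (L^j η)⁻¹ = L^{k−j}` ([Balaban1985Variational] (9)–(10)'s scale factor).  §2 **`recordVP P ι av reg k regB :
  B11.VarProblem`** — `Cfg := GaugeField P 0 G`, `Bdry := GaugeField P k G`, `InU e U := U ∈ reg e`, `InB V U := Averaging.iter av k U = V`,
  `Reg7 e V := V ∈ regB e`, **`OnMinimalOrbit e V U := Setup.IsBackground av (reg e) k V U`** ([dict] D-3 BY `Iff.rfl`: `onMinimalOrbit_iff`),
  `UniqueCriticalOrbit := True`, cubes `(j, y, K) : Fin (k+1) × Site × ℕ` (scale `j ≤ k`, centre `y`, `l¹`-radius `K`, `sizeM = (2K+1)∕(2L^j)`),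
  `eta = L^{−k}`, `L = P.L` (row NE7's `hetaA`∕`hPLA` by `rfl`), regularity fields = `SubstrateGaugeSize` on `liftCfg ι U`;
  **`realisesRecord : Realises (recordVP …) P.d (Matrix n n ℂ)`** with `cfg := liftCfg ι`, `gauge := realisesGauge_of_gaugedAt` (BY CONSTRUCTION);
  **`regularity_iff`** (`B11.Regularity` at a cube ⇔ `GaugedAt ∧ g < B₃Mε₁ ∧ g < B₄Mε₁`); `exists8_of_background` (any `Setup.Background` with
  class `reg (B₃ε₁)` realises (8) on its domain — row NE7's `hUA` ∕ row NE3's A-H1 at the object of record).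
* §3 **`exists8_recordVP_of_reachable`**: on a compact Hausdorff group with continuous `Re tr`, continuous averagings and a closed class, (8) of the
  problem of record HOLDS for every REACHABLE datum — `SubstrateBackground.backgroundOfRecordCompact` BY NAME (= `Thm1At`'s existence clause only if
  `regB ε₁ ⊆ reachable`; regularity ∕ uniqueness stay displayed; the continuity binder is S-BG∃'s, discharged at the ℰ of record by
  `SubstrateBlockAvgContinuity` in the `ContinuousOn` form — `exists8_recordVP_of_reachable_of_continuousOn`).
* §4 **AT THE AVERAGING OF RECORD ON `SU(n)`, NO DISPLAYED HYPOTHESIS**: `avSU := blockAvg expMeanLogSU`, `regSU := nestedSmallAll … (δ_SU∕2)`;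
  **`exists8_recordVP_SU`** — (8) for every reachable datum (`isClosed_nestedSmallAll` + `continuousOn_iter_blockAvg` + `backgroundOfRecordOn`); `…_SU_one`.
* §5 NE7's `hAU` at the realisation of record: `isPeriodic_liftCfg` (`T4TermwiseTorus.IsPeriodic (N_j) (liftCfg ι U)`), `realisesRecord_cfg_mem_unitaryUnits`
  (`ι` into `unitaryUnits`), `isPeriodic_realisesRecord_cfg`.  §6 cubes for NE7's `hcoverA`: `exists_cube` (every `(j, y, K)`), `cover_clause_iff`.
* §7 SOCKET FIT: **`holderReg_liftCfg_of_thm1At`** = ONE CALL of NE7's `TermwiseHolder.holderReg_of_thm1At` at `famA := recordVP`, `ρA := realisesRecord`.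
DIVERGENCES (module-level; cell rows D-rec-1…6, MAP §O1 v0.7): (D-rec-1) common-factor regularity ⇒ Theorem 1 with `(B₃, B₄)` gives the typed
`Regularity` with both ↦ `max(B₃, B₄)` (the same `B₃` also sets the CLASS radius `B₃ε₁` of `Exists8 ∕ OnMinimalOrbit`); (D-rec-2) (10) rides on the same
factor — weaker than print; (D-rec-3) uniqueness NOT modelled; (D-rec-4) `Gauged := GaugedAt` is the WITNESSED form — «a gauge exists» ⇒ `GaugedAt` is
`SubstrateGaugeSizeAttained`; (D-rec-5) cubes are `l¹`-balls of radius `K` inside the printed sup-cube of side `2ML^j = 2K+1` sites; (D-rec-6, located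
R-ne9leaf07g13-2) the CLASS of cubes is NOT modelled — `Cube := Fin (k+1) × Site × ℕ` admits every ball, so `Reg910` inside `Thm1At Cst (recordVP …)`
asks (9) on EVERY ball with `(2K+1)∕(2L^j) ≤ M(ε₁)`, cube-wise STRONGER than print (class cubes only: aligned, `M ∈ R₁M₁ℕ`, `□̃`-containment).
RUN B (located R-ne9leaf07g13-1, OPEN for the NE7 instancer): NE7's coarse END reads BOTH runs with ONE `(M, L, K)` (`hetaB = (L^K)⁻¹`, period
`M·L^{K+1}`); run A's letters are literal here at `M = 2L^{m−1}` (§5, §7), whereas `recordVP (F.P (K+1)) ι av reg (K+1) regB` has `eta = (L^{K+1})⁻¹`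
and period `2·L^{m+K+1}` — which object is «run B's background» in the END's (repr) identification is not decided by this module.
-/

noncomputable section

open scoped BigOperators

namespace Summit.QuantumFields.BalabanUV.T4Continuum.SubstrateVarProblemOfRecord

open Literature.MathematicalPhysics.QuantumFieldTheory.Balaban1983to89
open B7Prop1Explicit (l1 e gaugeAct expUnit U1)
open B11 (VarProblem Regularity)
open B11Thm1 (Thm1At Exists8 Reg910 Consts)
open TermwiseHolder (Realises HolderReg)
open SubstrateGaugeSize
open SubstrateVocabularyV3 (liftCfg)

/-! ## §1 Spacing and scale factors -/

/-- The lattice spacing `η = L^{−k}` of the level-`k` problem in `L^k`-units ([Balaban1985Variational] p. 278: «U on Ω₀ (spacing η = L^{−k})»,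
the SHAPE). [folklore] -/
def eta (L k : ℕ) : ℝ := ((L : ℝ) ^ k)⁻¹

/-- The scale factor `s_j = (L^j η)⁻¹ = L^{k−j}` of a cube of scale `j` ([Balaban1985Variational] (9)–(10): the powers of `(L^jη)^{−1}`). [folklore] -/
def sf (L k j : ℕ) : ℝ := ((L : ℝ) ^ j * eta L k)⁻¹

/-- `η > 0` for `L ≥ 1`. [folklore] -/
theorem eta_pos {L : ℕ} (hL : 1 ≤ L) (k : ℕ) : 0 < eta L k := by
  unfold eta
  have : (0 : ℝ) < L := by exact_mod_cast hL
  positivity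

/-- `η ≤ 1` for `L ≥ 1`. [folklore] -/
theorem eta_le_one {L : ℕ} (hL : 1 ≤ L) (k : ℕ) : eta L k ≤ 1 := by
  unfold eta
  have h1 : (1 : ℝ) ≤ (L : ℝ) ^ k := one_le_pow₀ (by exact_mod_cast hL)
  exact inv_le_one_of_one_le₀ h1

/-- `s_j = L^{k−j}` for `j ≤ k`. [folklore] -/
theorem sf_eq_pow {L : ℕ} (hL : 1 ≤ L) {k j : ℕ} (hj : j ≤ k) : sf L k j = (L : ℝ) ^ (k - j) := by
  unfold sf eta
  have hL0 : (L : ℝ) ≠ 0 := by exact_mod_cast (by omega : L ≠ 0)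
  rw [mul_inv_rev, inv_inv, ← pow_sub₀ _ hL0 hj]

/-- `s_j > 0`. [folklore] -/
theorem sf_pos {L : ℕ} (hL : 1 ≤ L) (k j : ℕ) : 0 < sf L k j := by
  unfold sf
  have : (0 : ℝ) < L := by exact_mod_cast hL
  have := eta_pos hL k
  positivity

/-- `1 ≤ s_j` for `j ≤ k`. [folklore] -/
theorem one_le_sf {L : ℕ} (hL : 1 ≤ L) {k j : ℕ} (hj : j ≤ k) : 1 ≤ sf L k j := by
  rw [sf_eq_pow hL hj]
  exact one_le_pow₀ (by exact_mod_cast hL)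

/-! ## §2 THE VARIATIONAL PROBLEM OF RECORD -/

section Record

open scoped Matrix.Norms.L2Operator

variable (P : Params) {G : Type} [GaugeGroup G] {n : Type} [Fintype n] [DecidableEq n] [Nonempty n]
  (ι : G →* (Matrix n n ℂ)ˣ) (av : ∀ j, Averaging P j G) (reg : ℝ → Set (GaugeField P 0 G)) (k : ℕ)
  (regB : ℝ → Set (GaugeField P k G))

/-- **THE VARIATIONAL PROBLEM OF RECORD at level `k`** — r2's abstract carrier `B11.VarProblem` ([Balaban1985Variational] (2)–(7) p. 278, (8)
p. 279, the SHAPE) INSTANTIATED on the tree's V1 objects: `Cfg` = finest-lattice fields `GaugeField P 0 G`, `Bdry` = level-`k` data, `InU e U := U ∈ reg e`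
(the regular class of record, a parameter), `InB V U := Averaging.iter av k U = V` (the constraint «Ū^k = V» for the AVERAGING OF RECORD `av`,
decision V-1), `Reg7 e V := V ∈ regB e`, **`OnMinimalOrbit e V U := Setup.IsBackground av (reg e) k V U`** (a Wilson-action minimiser on the
constraint surface within the class — [dict] D-3 BY `Iff.rfl`, `onMinimalOrbit_iff`), `UniqueCriticalOrbit := True` (NOT modelled, as row NE3's
D-s3-5), cubes `(j, y, K)` of scale `j ≤ k`, centre `y`, `l¹`-radius `K`, `sizeM = (2K+1)∕(2L^j)` (side `2ML^j` sites), `eta = L^{−k}`, `L = P.L`,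
and the regularity fields of `SubstrateGaugeSize` read on the lift `liftCfg ι U` (V3 reading of record, `SubstrateVocabularyV3`):
`Gauged := GaugedAt`, `normA := s·g`, `normGradA := s²·g`, `holderA β := s^{2+β}·g`, `normLapA := s³·g` (`s = sf P.L k j`, `g` the gauge size).
DIVERGENCES: (D-rec-1) common factor ⇒ `B11.Regularity` reads `g < min(B₃, B₄)·M·ε₁` (`regularity_iff`): print's Theorem 1 with constants
`(B₃, B₄)` gives the typed one with both replaced by `max(B₃, B₄)`; (D-rec-2) (10) is carried by the same factor (no separate second-difference
clause) — weaker than print there; (D-rec-3) uniqueness NOT modelled; (D-rec-4) `Gauged` is the WITNESSED form (a gauge achieving the least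
factor) — reduction from «a gauge exists» = follower `SubstrateGaugeSizeAttained`.  `Thm1At C (recordVP …)` is asserted NOWHERE: it is row NE7 ∕
NE3's displayed hypothesis = B11 Theorem 1 FOR THE `av`-CONSTRAINED PROBLEM ([Balaban1987RG1] p. 253 «valid universally for all averages
satisfying the above properties» [sc. (0.5)–(0.9)] is print's claim, not the tree's). [folklore] -/
def recordVP : VarProblem where
  Cfg := GaugeField P 0 G
  Bdry := GaugeField P k G
  Cube := Fin (k + 1) × B7Prop1Explicit.Site P.d × ℕ
  scale := fun c => c.1
  sizeM := fun c => (2 * (c.2.2 : ℝ) + 1) / (2 * (P.L : ℝ) ^ (c.1 : ℕ))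
  eta := eta P.L k
  L := P.L
  InU := fun e U => U ∈ reg e
  InB := fun V U => Averaging.iter av k U = V
  Reg7 := fun e V => V ∈ regB e
  OnMinimalOrbit := fun e V U => IsBackground av (reg e) k V U
  UniqueCriticalOrbit := fun _ _ _ => True
  Gauged := fun U c => GaugedAt (liftCfg ι U) c.2.1 c.2.2 (eta P.L k) (sf P.L k c.1)
  normA := fun U c => sf P.L k c.1 * gaugeSize (liftCfg ι U) c.2.1 c.2.2 (eta P.L k) (sf P.L k c.1)
  normGradA := fun U c => sf P.L k c.1 ^ 2 * gaugeSize (liftCfg ι U) c.2.1 c.2.2 (eta P.L k) (sf P.L k c.1)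
  holderA := fun U c β => sf P.L k c.1 ^ (2 + β) * gaugeSize (liftCfg ι U) c.2.1 c.2.2 (eta P.L k) (sf P.L k c.1)
  normLapA := fun U c => sf P.L k c.1 ^ 3 * gaugeSize (liftCfg ι U) c.2.1 c.2.2 (eta P.L k) (sf P.L k c.1)

/-- **[dict] D-3 FOR THE PROBLEM OF RECORD**: «on the minimal orbit» IS `Setup.IsBackground` (`Iff.rfl`). [folklore] -/
theorem onMinimalOrbit_iff (e : ℝ) (V : GaugeField P k G) (U : GaugeField P 0 G) :
    (recordVP P ι av reg k regB).OnMinimalOrbit e V U ↔ IsBackground av (reg e) k V U :=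
  Iff.rfl

/-- The constraint of record unfolds: `InB V U ↔ M^k U = V`. [folklore] -/
theorem inB_iff (V : GaugeField P k G) (U : GaugeField P 0 G) :
    (recordVP P ι av reg k regB).InB V U ↔ Averaging.iter av k U = V :=
  Iff.rfl

/-- The class of record unfolds. [folklore] -/
theorem inU_iff (e : ℝ) (U : GaugeField P 0 G) : (recordVP P ι av reg k regB).InU e U ↔ U ∈ reg e := Iff.rfl

/-- `L` of the carrier is the block size of record (row NE7's `hPLA`). [folklore] -/
@[simp] theorem L_recordVP : (recordVP P ι av reg k regB).L = (P.L : ℝ) := rfl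

/-- `eta` of the carrier is `L^{−k}` (row NE7's `hetaA`). [folklore] -/
@[simp] theorem eta_recordVP : (recordVP P ι av reg k regB).eta = ((P.L : ℝ) ^ k)⁻¹ := rfl

/-- The scale of a cube is its first component. [folklore] -/
@[simp] theorem scale_recordVP (c : Fin (k + 1) × B7Prop1Explicit.Site P.d × ℕ) :
    (recordVP P ι av reg k regB).scale c = (c.1 : ℕ) := rfl

/-- The size parameter of a cube `(j, y, K)` is `(2K+1)∕(2L^j)`. [folklore] -/
@[simp] theorem sizeM_recordVP (c : Fin (k + 1) × B7Prop1Explicit.Site P.d × ℕ) :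
    (recordVP P ι av reg k regB).sizeM c = (2 * (c.2.2 : ℝ) + 1) / (2 * (P.L : ℝ) ^ (c.1 : ℕ)) := rfl

/-- **THE EXISTENCE CLAUSE (8) FROM A BACKGROUND**: every `Setup.Background P G av` with class `reg (B₃ε₁)` realises `Exists8` of the problem of
record on its domain — row NE3's A-H1 ∕ row NE7's `hUA` AT THE OBJECT OF RECORD, by name. [folklore] -/
theorem exists8_of_background {B₃ ε₁ : ℝ} (Bg : Background P G av) (hreg : Bg.reg = reg (B₃ * ε₁)) {V : GaugeField P k G}
    (hV : V ∈ Bg.dom k) : Exists8 (recordVP P ι av reg k regB) B₃ ε₁ V := by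
  have h := Bg.isBackground k V hV
  rw [hreg] at h
  exact ⟨Bg.U k V, h.2.1, h.1, h⟩

/-- **THE REALISATION OF RECORD** of the carrier on the concrete lattice: `cfg := liftCfg ι` (the V3 reading), `centre (j, y, K) := y`,
`radius (j, y, K) := K`, and the `gauge` clause BY CONSTRUCTION of the regularity fields (`SubstrateGaugeSize.realisesGauge_of_gaugedAt`) —
row NE7's `ρA ∕ ρB` at the object of record. [folklore] -/
def realisesRecord : Realises (recordVP P ι av reg k regB) P.d (Matrix n n ℂ) where
  cfg := fun U => liftCfg ι U
  centre := fun c => c.2.1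
  radius := fun c => c.2.2
  gauge := fun _ _ h => realisesGauge_of_gaugedAt h

/-- The realisation reads configurations through the lift of record (`rfl`). [folklore] -/
@[simp] theorem realisesRecord_cfg (U : GaugeField P 0 G) : (realisesRecord P ι av reg k regB).cfg U = liftCfg ι U := rfl

/-- **`B11.Regularity` FOR THE PROBLEM OF RECORD = ONE INEQUALITY ON THE COMMON FACTOR**: at a cube `c = (j, y, K)`,
`Regularity (recordVP …) B₃ B₄ ε₁ U c ↔ GaugedAt … ∧ g < B₃·M·ε₁ ∧ g < B₄·M·ε₁` (`M = sizeM c`, `g` the gauge size of `liftCfg ι U` on the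
ball; divergence D-rec-1). [folklore] -/
theorem regularity_iff (hL : 1 ≤ P.L) {B₃ B₄ ε₁ : ℝ} (U : GaugeField P 0 G) (c : Fin (k + 1) × B7Prop1Explicit.Site P.d × ℕ) :
    Regularity (recordVP P ι av reg k regB) B₃ B₄ ε₁ U c ↔
      GaugedAt (liftCfg ι U) c.2.1 c.2.2 (eta P.L k) (sf P.L k c.1) ∧
        gaugeSize (liftCfg ι U) c.2.1 c.2.2 (eta P.L k) (sf P.L k c.1) < B₃ * ((2 * (c.2.2 : ℝ) + 1) / (2 * (P.L : ℝ) ^ (c.1 : ℕ))) * ε₁ ∧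
        gaugeSize (liftCfg ι U) c.2.1 c.2.2 (eta P.L k) (sf P.L k c.1) < B₄ * ((2 * (c.2.2 : ℝ) + 1) / (2 * (P.L : ℝ) ^ (c.1 : ℕ))) * ε₁ := by
  set g := gaugeSize (liftCfg ι U) c.2.1 c.2.2 (eta P.L k) (sf P.L k c.1) with hg
  set M := (2 * (c.2.2 : ℝ) + 1) / (2 * (P.L : ℝ) ^ (c.1 : ℕ)) with hM
  have hs : 0 < sf P.L k c.1 := sf_pos hL k c.1
  have hsf : ((recordVP P ι av reg k regB).L ^ (recordVP P ι av reg k regB).scale c * (recordVP P ι av reg k regB).eta)⁻¹ =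
      sf P.L k c.1 := rfl
  unfold Regularity
  rw [hsf]
  simp only [recordVP, pow_one]
  constructor
  · rintro ⟨hG, h1, -, h3, -⟩
    refine ⟨hG, ?_, ?_⟩
    · rwa [mul_comm (sf P.L k c.1) g, mul_lt_mul_iff_of_pos_right hs] at h1
    · have h30 := h3 0 le_rfl zero_le_one
      rw [add_zero] at h30
      have e2 : sf P.L k (c.1 : ℕ) ^ (2 : ℝ) = sf P.L k c.1 ^ (2 : ℕ) := Real.rpow_natCast _ 2
      rw [e2, mul_comm (sf P.L k c.1 ^ 2) g, mul_lt_mul_iff_of_pos_right (pow_pos hs 2)] at h30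
      exact h30
  · rintro ⟨hG, h3', h4'⟩
    refine ⟨hG, ?_, ?_, fun β hβ0 hβ1 => ?_, ?_⟩
    · rwa [mul_comm (sf P.L k c.1) g, mul_lt_mul_iff_of_pos_right hs]
    · rw [mul_comm (sf P.L k c.1 ^ 2) g, mul_lt_mul_iff_of_pos_right (pow_pos hs 2)]; exact h3'
    · rw [mul_comm (sf P.L k c.1 ^ (2 + β)) g, mul_lt_mul_iff_of_pos_right (Real.rpow_pos_of_pos hs _)]; exact h4'
    · rw [mul_comm (sf P.L k c.1 ^ 3) g, mul_lt_mul_iff_of_pos_right (pow_pos hs 3)]; exact h3'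

end Record

/-! ## §3 Non-vacuity of (8) on compact groups: the existence clause of Theorem 1 for the problem of record is the tree's -/

section Compact

open scoped Matrix.Norms.L2Operator

variable (P : Params) {G : Type} [GaugeGroup G] [TopologicalSpace G] [IsTopologicalGroup G] [CompactSpace G] [T2Space G]
  {n : Type} [Fintype n] [DecidableEq n] [Nonempty n]
  (ι : G →* (Matrix n n ℂ)ˣ) (av : ∀ j, Averaging P j G) (reg : ℝ → Set (GaugeField P 0 G)) (k : ℕ)
  (regB : ℝ → Set (GaugeField P k G))

/-- **(8) OF THE PROBLEM OF RECORD HOLDS ON THE REACHABLE DATA** (compact Hausdorff `G`, continuous `Re tr`, continuous averagings, closed class):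
`Exists8 (recordVP …) B₃ ε₁ V` for every `V = M^k U`, `U ∈ reg (B₃ε₁)` — `SubstrateBackground.backgroundOfRecordCompact` BY NAME; the EXISTENCE
third of `Thm1At` for the problem of record is thus the tree's, not print's (the regularity and uniqueness thirds stay displayed). [folklore] -/
theorem exists8_recordVP_of_reachable (hreTr : Continuous (reTr : G → ℝ)) (hav : ∀ j, Continuous (av j).avg) {B₃ ε₁ : ℝ}
    (hreg : IsClosed (reg (B₃ * ε₁))) {V : GaugeField P k G} (hV : V ∈ SubstrateBackground.reachable av (reg (B₃ * ε₁)) k) :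
    Exists8 (recordVP P ι av reg k regB) B₃ ε₁ V :=
  exists8_of_background P ι av reg k regB (SubstrateBackground.backgroundOfRecordCompact hreTr av hav (reg (B₃ * ε₁)) hreg) rfl hV

/-- The same with continuity of `M^k` ON THE CLASS only (`SubstrateBackground.backgroundOfRecordOn` BY NAME) — the form dischargeable at the
small-loop average of record, whose guarded (0.4) map is continuous on the nested small classes but not globally. [folklore] -/
theorem exists8_recordVP_of_reachable_of_continuousOn (hreTr : Continuous (reTr : G → ℝ)) {B₃ ε₁ : ℝ} (hreg : IsClosed (reg (B₃ * ε₁)))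
    (hiter : ∀ k', ContinuousOn (Averaging.iter av k') (reg (B₃ * ε₁))) {V : GaugeField P k G}
    (hV : V ∈ SubstrateBackground.reachable av (reg (B₃ * ε₁)) k) :
    Exists8 (recordVP P ι av reg k regB) B₃ ε₁ V :=
  exists8_of_background P ι av reg k regB (SubstrateBackground.backgroundOfRecordOn hreTr av (reg (B₃ * ε₁)) hreg hiter) rfl hV

end Compact

/-! ## §4 At the averaging OF RECORD on `SU(n)`, HYPOTHESIS-FREE: (8) holds on the reachable data of the all-level nested small class -/

section RecordSU

open scoped Matrix.Norms.L2Operator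
open ExpMeanLog SubstrateBlockAvgContinuity

variable (P : Params) {n : Type} [Fintype n] [DecidableEq n] [Nonempty n]
  (ι : Matrix.specialUnitaryGroup n ℂ →* (Matrix n n ℂ)ˣ) (k : ℕ)
  (regB : ℝ → Set (GaugeField P k (Matrix.specialUnitaryGroup n ℂ)))

/-- The averaging OF RECORD on `SU(n)`: [Balaban1987RG1] (0.4) with the printed inner operation `expMeanLogSU` (decision V-1; the SHAPE). [folklore] -/
abbrev avSU : ∀ j, Averaging P j (Matrix.specialUnitaryGroup n ℂ) := fun _ => BlockAveraging.blockAvg expMeanLogSU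

/-- The class OF RECORD on `SU(n)` (radius-blind): the all-level nested small-loop class with margin `δ_SU∕2` of `SubstrateDrivenRecordSU` —
the class of `drivenRecordSU`'s backgrounds. [folklore] -/
abbrev regSU : ℝ → Set (GaugeField P 0 (Matrix.specialUnitaryGroup n ℂ)) :=
  fun _ => nestedSmallAll (P := P) expMeanLogSU ((expMeanLogSU (n := n)).δ / 2)

/-- **(8) OF THE PROBLEM OF RECORD ON `SU(n)`, NO DISPLAYED HYPOTHESIS**: for the averaging of record `blockAvg expMeanLogSU` and the class of
record `nestedSmallAll … (δ_SU∕2)`, every reachable level-`k` datum `V` has a constrained Wilson minimiser in the class — `Exists8 (recordVP …) B₃ ε₁ V`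
— by compactness of `SU(n)`, closedness of the class and continuity of `M^k` ON it (`isClosed_nestedSmallAll`, `continuousOn_iter_blockAvg`,
`backgroundOfRecordOn`, all BY NAME).  `Thm1At`'s existence clause for THIS carrier is the tree's ON THE REACHABLE DATA; regularity ∕ uniqueness stay
displayed. [folklore] -/
theorem exists8_recordVP_SU {B₃ ε₁ : ℝ} {V : GaugeField P k (Matrix.specialUnitaryGroup n ℂ)}
    (hV : V ∈ SubstrateBackground.reachable (avSU P) (nestedSmallAll (P := P) expMeanLogSU ((expMeanLogSU (n := n)).δ / 2)) k) :
    Exists8 (recordVP P ι (avSU P) (regSU P) k regB) B₃ ε₁ V :=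
  exists8_of_background P ι (avSU P) (regSU P) k regB
    (SubstrateBackground.backgroundOfRecordOn SubstrateBackground.continuous_reTr_specialUnitaryGroup (avSU P)
      (nestedSmallAll (P := P) expMeanLogSU ((expMeanLogSU (n := n)).δ / 2))
      (isClosed_nestedSmallAll _ continuous_dist1_SU smallContinuous_expMeanLogSU half_deltaSU_lt)
      (fun k' => (continuousOn_iter_blockAvg _ continuous_dist1_SU smallContinuous_expMeanLogSU half_deltaSU_lt k').mono
        (nestedSmallAll_subset _ _ k')))
    rfl hV

/-- The trivial datum is reachable at every level for the class of record (`1 ∈ nestedSmallAll`, `M^k 1 = 1`), so (8) of the problem of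
record on `SU(n)` is NON-VACUOUS. [folklore] -/
theorem exists8_recordVP_SU_one (B₃ ε₁ : ℝ) :
    Exists8 (recordVP P ι (avSU P) (regSU P) k regB) B₃ ε₁
      (Averaging.iter (avSU P) k (1 : GaugeField P 0 (Matrix.specialUnitaryGroup n ℂ))) :=
  exists8_recordVP_SU P ι k regB
    (SubstrateBackground.iter_mem_reachable (avSU P) (one_mem_nestedSmallAll _ (fun _ => ESU_const_one) half_deltaSU_nonneg) k)

end RecordSU

/-! ## §5 Row NE7's `hAU ∕ hBU` at the realisation of record: unitarity and torus periodicity of `cfg U = liftCfg ι U` -/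

section Torus

open scoped Matrix.Norms.L2Operator

variable {P : Params} {G : Type} [GaugeGroup G] {n : Type} [Fintype n] [DecidableEq n] [Nonempty n] {j : ℕ}

/-- Translation by `N_j • m` (any integer vector `m`) does not change the torus site. [folklore] -/
theorem toZMod_add_period_smul (x m : B7Prop1Explicit.Site P.d) :
    SubstrateVocabularyV3.toZMod (P := P) j (x + (P.sitesPerDir j : ℤ) • m) = SubstrateVocabularyV3.toZMod j x := by
  funext ν
  simp [SubstrateVocabularyV3.toZMod_apply]

omit [Nonempty n] in
/-- **THE LIFT IS A TORUS FIELD in row NE7's sense** (`T4TermwiseTorus.IsPeriodic (N_j) (liftCfg ι U)`: invariance under ALL translations by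
`N_j`-multiples of integer vectors) — the periodicity half of NE7's `hAU ∕ hBU` at `cfg := liftCfg ι`. [folklore] -/
theorem isPeriodic_liftCfg (ι : G →* (Matrix n n ℂ)ˣ) (U : GaugeField P j G) :
    T4TermwiseTorus.IsPeriodic (P.sitesPerDir j) (liftCfg ι U) :=
  fun x m => SubstrateVocabularyV3.liftCfg_eq_of_toZMod_eq ι U (toZMod_add_period_smul x m)

variable (P) (ι : G →* (Matrix n n ℂ)ˣ) (av : ∀ j, Averaging P j G) (reg : ℝ → Set (GaugeField P 0 G)) (k : ℕ)
  (regB : ℝ → Set (GaugeField P k G))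

/-- **NE7's `hAU ∕ hBU`, unitarity half, at the realisation of record**: for `ι` with values in the unitary units every realised configuration is
`unitaryUnits`-valued (`SubstrateVocabularyV3.isUnitaryCfg_liftCfg` BY NAME). [folklore] -/
theorem realisesRecord_cfg_mem_unitaryUnits (hι : ∀ g, ι g ∈ B7Prop2Explicit.unitaryUnits (Matrix n n ℂ)) (U : GaugeField P 0 G)
    (x : B7Prop1Explicit.Site P.d) (κ : Fin P.d) : (realisesRecord P ι av reg k regB).cfg U x κ ∈ B7Prop2Explicit.unitaryUnits (Matrix n n ℂ) :=
  SubstrateVocabularyV3.isUnitaryCfg_liftCfg ι hι U x κ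

/-- **NE7's `hAU ∕ hBU`, periodicity half, at the realisation of record**: period `N_0 = P.sitesPerDir 0` (the finest torus of the problem). [folklore] -/
theorem isPeriodic_realisesRecord_cfg (U : GaugeField P 0 G) :
    T4TermwiseTorus.IsPeriodic (P.sitesPerDir 0) ((realisesRecord P ι av reg k regB).cfg U) :=
  isPeriodic_liftCfg ι U

end Torus

/-! ## §6 Cubes for row NE7's covering binders `hcoverA ∕ hcoverB`: every (scale, centre, radius) is a cube of the carrier -/

section Cubes

open scoped Matrix.Norms.L2Operator

variable (P : Params) {G : Type} [GaugeGroup G] {n : Type} [Fintype n] [DecidableEq n] [Nonempty n]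
  (ι : G →* (Matrix n n ℂ)ˣ) (av : ∀ j, Averaging P j G) (reg : ℝ → Set (GaugeField P 0 G)) (k : ℕ)
  (regB : ℝ → Set (GaugeField P k G))

/-- **CUBES ON DEMAND**: for every scale `j ≤ k`, centre `y` and `l¹`-radius `K` the carrier has the cube `(j, y, K)` with `scale = j`,
`sizeM = (2K+1)∕(2L^j)`, realised with `centre = y`, `radius = K` — so NE7's `hcoverA∕hcoverB` («a cube of the window's level around every window
plaquette with `l1 (x − centre c) + 6 ≤ radius c` and `sizeM c ≤ Mc`») reduce at the object of record to the arithmetic `(2K+1)∕(2L^j) ≤ Mc`. [folklore] -/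
theorem exists_cube (j : Fin (k + 1)) (y : B7Prop1Explicit.Site P.d) (K : ℕ) :
    ∃ c : (recordVP P ι av reg k regB).Cube,
      (recordVP P ι av reg k regB).scale c = (j : ℕ) ∧
        (recordVP P ι av reg k regB).sizeM c = (2 * (K : ℝ) + 1) / (2 * (P.L : ℝ) ^ (j : ℕ)) ∧
          (realisesRecord P ι av reg k regB).centre c = y ∧ (realisesRecord P ι av reg k regB).radius c = K :=
  ⟨(j, y, K), rfl, rfl, rfl, rfl⟩

/-- The covering clause of NE7's `hcoverA` at a cube `(j, y, K)` of the carrier of record is the `l¹`-inequality `l1 (x − y) + 6 ≤ K`. [folklore] -/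
theorem cover_clause_iff (j : Fin (k + 1)) (y x : B7Prop1Explicit.Site P.d) (K : ℕ) :
    l1 (x - (realisesRecord P ι av reg k regB).centre (j, y, K)) + 6 ≤ (realisesRecord P ι av reg k regB).radius (j, y, K) ↔
      l1 (x - y) + 6 ≤ K :=
  Iff.rfl

end Cubes

/-! ## §7 SOCKET FIT (kernel): row NE7's `holderReg_of_thm1At` accepts `famA := recordVP`, `ρA := realisesRecord` VERBATIM -/

section Socket

open scoped Matrix.Norms.L2Operator

variable (P : Params) {G : Type} [GaugeGroup G] {n : Type} [Fintype n] [DecidableEq n] [Nonempty n]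
  (ι : G →* (Matrix n n ℂ)ˣ) (av : ∀ j, Averaging P j G) (reg : ℝ → Set (GaugeField P 0 G)) (k : ℕ)
  (regB : ℝ → Set (GaugeField P k G))

/-- **NE7's B-KIND CHAIN AT THE CARRIER OF RECORD (one call of `TermwiseHolder.holderReg_of_thm1At`)**: under the row's displayed `Thm1At Cst
(recordVP …)`, a datum `V ∈ regB ε₁` and a BACKGROUND OF RECORD `U` (`IsBackground av (reg (B₃ε₁)) k V U`) have, on every cube `(j, y, K)` with
`(2K+1)∕(2L^j) ≤ M(ε₁)`, `HolderReg (liftCfg ι U) y K η …` with the printed (9) constants — no binder of NE7's END is re-typed. [folklore] -/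
theorem holderReg_liftCfg_of_thm1At (hL : 1 ≤ P.L) (Cst : B11Thm1.Consts) (hT : Thm1At Cst (recordVP P ι av reg k regB)) {ε₁ : ℝ}
    (hε₁ : 0 < ε₁) (hε₁a : ε₁ ≤ Cst.a₁) {V : GaugeField P k G} (hV : V ∈ regB ε₁) {U : GaugeField P 0 G}
    (hU : IsBackground av (reg (Cst.B₃ * ε₁)) k V U) (j : Fin (k + 1)) (y : B7Prop1Explicit.Site P.d) (K : ℕ)
    (hc : (2 * (K : ℝ) + 1) / (2 * (P.L : ℝ) ^ (j : ℕ)) ≤ Cst.Mfun ε₁) {β₀ : ℝ} (hβ₀ : 0 ≤ β₀) (hβ₀1 : β₀ ≤ 1) :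
    HolderReg (liftCfg ι U) y K (eta P.L k)
      (Cst.B₃ * ((2 * (K : ℝ) + 1) / (2 * (P.L : ℝ) ^ (j : ℕ))) * ε₁ * sf P.L k j ^ 1)
      (Cst.B₃ * ((2 * (K : ℝ) + 1) / (2 * (P.L : ℝ) ^ (j : ℕ))) * ε₁ * sf P.L k j ^ 2) β₀
      (Cst.B₄ * ((2 * (K : ℝ) + 1) / (2 * (P.L : ℝ) ^ (j : ℕ))) * ε₁ * sf P.L k j ^ (2 + β₀)) :=
  TermwiseHolder.holderReg_of_thm1At (realisesRecord P ι av reg k regB) (eta_pos hL k).le Cst hT hε₁ hε₁a (V := V) hV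
    (U := U) hU (c := (j, y, K)) hc hβ₀ hβ₀1

end Socket

end Summit.QuantumFields.BalabanUV.T4Continuum.SubstrateVarProblemOfRecord


end
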